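import Literature.AlgebraicGeometry.Deligne1982.WeilSpaceComplexification
import Mathlib.RingTheory.Flat.Basic
import HarnessLib

/-!
# Deligne 1982, §4 p. 30 / Moonen–Zarhin §1: `d[E:ℚ] = 2 dim A` and `dim W_F ⊗ ℂ = [F:ℚ] · binom(dim_F H¹, r)`

P. Deligne, *Hodge cycles on abelian varieties* (notes by J. S. Milne), LNM 900 (1982), I §4, p. 30
(TeXed re-edition, L17–18): "Let `d` be the dimension of `H₁(A, ℚ)` over `E`, so that
`d[E:ℚ] = 2 dim A`", and in the proof of Prop. 4.4 (p. 30): "Each `H¹_{B,σ}` has dimension `d`",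
so that each summand `⋀^d H¹_{B,σ}` of `⋀^d_E H¹_B ⊗ ℂ ⥲ ⊕_{σ ∈ S} ⋀^d H¹_{B,σ}` is a line.
B. Moonen, Yu. Zarhin, *Weil classes on abelian varieties*, Crelle 496 (1998), §1: "`r = 2g/[F:ℚ]`.
The 1-dimensional `F`-vector space `W_F = W_F(X) := ⋀^r_F V_X`", "Since `dim_F(W_F) = 1` …".
B. van Geemen, LNM 1594 (1994), 4.9: "the two dimensional `ℚ`-vector space `⋀^{2n}_K H¹(X, ℚ)`"
(`[K:ℚ] = 2`).

This file is the DIMENSION bookkeeping for the identification of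
`Deligne1982/WeilSpaceComplexification.lean`
(`weilClassesField A φ P r = β_r(weilSpace A F r ⊗ ℂ)`), all PROVED, no definition, no named fact:

* `finrank_mul_finrank_bettiCohomology_one` — **`[F:ℚ] · dim_F H¹(A(ℂ); ℚ) = 2 dim A`**
  ("`d[E:ℚ] = 2 dim A`"; tower law with `b₁ = 2 dim A`,
  `Motives.AbelianVariety.finrank_bettiCohomology_one_eq_of_natCard_torsionPoints`).
* `finrank_weilSpace` — **`dim_ℚ W_F = [F:ℚ] · binom(dim_F H¹, r)`** for `r ≠ 0`
  (`W_F ≅ ⋀^r_F H¹`: Deligne's section `s` is injective in positive degree,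
  `sectionExteriorPowerOver_injective`, and `e_r` is an isomorphism; Mathlib's
  `exteriorPower.finrank_eq`); `finrank_weilSpace_self` — **`dim_ℚ W_F = [F:ℚ]`** in the degree
  `r = dim_F H¹` ("the 1-dimensional `F`-vector space `W_F`").
* `finrank_baseChange_complex` — `dim_ℂ (W ⊗ ℂ) = dim_ℚ W` for a `ℚ`-subspace (`ℂ` flat over `ℚ`).
* `finrank_weilClassesField_eq_finrank_weilSpace`, `finrank_weilClassesField` — under the hypotheses of
  the identification, **`dim_ℂ weilClassesField A φ P r = dim_ℚ W_F = [F:ℚ] · binom(dim_F H¹, r)`**.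
* `finrank_weilClassesField_eq_natDegree` — for the tree's presentation `F = ℚ[T]/(P)` with
  EXACTLY the hypotheses of `HodgeTheory.MoonenZarhin1998_weilClasses_hodgeCriterion` (`P`
  irreducible over `ℚ` of degree `e`, `P(φ) = 0`, `e · r = 2 dim A`) and `r ≠ 0`:
  **`dim_ℂ weilClassesField A φ P r = e`** — the complexified space of Weil classes (the carrier of
  `RankFourFaces.RankFourWeilClasses`, `r = 4`) is the direct sum of `e = [F:ℚ]` lines
  `⋀^r V_{ℂ,σ}`, one for each complex root of `P`.

## References

* [Deligne1982HodgeCycles] P. Deligne, *Hodge cycles on abelian varieties*, LNM 900 (1982), §4 p. 30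
  ("d[E:ℚ] = 2 dim A"; "Each H¹_{B,σ} has dimension d"), proof of Prop. 4.4. Cell `pub-hodgecm2`,
  unit `pub-hodgecm2-lit-deligne`, gen 73; binder table `HOME/lit/deligne82.md` row 12′h.
* [MoonenZarhin1998WeilClasses] B. J. J. Moonen, Yu. G. Zarhin, *Weil classes on abelian varieties*,
  J. reine angew. Math. 496 (1998), §1 ("The 1-dimensional F-vector space W_F"; "dim_F(W_F) = 1").
* [vanGeemen1994HodgeAV] B. van Geemen, *An introduction to the Hodge conjecture for abelian
  varieties*, LNM 1594 (1994), 4.9 ("the two dimensional ℚ-vector space ⋀^{2n}_K H¹(X, ℚ)").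
* [MumfordAV1970] D. Mumford, *Abelian Varieties* (1970), §1 (3) (`H¹(X, ℤ) ≅ ℤ^{2g}`).
-/

noncomputable section

open Module Function TensorProduct Polynomial
open CategoryTheory

namespace Literature.AlgebraicGeometry.Deligne1982

open Literature.AlgebraicTopology.SingularHomology
open Literature.AlgebraicGeometry.HodgeTheory
open Literature.AlgebraicGeometry.Motives (AbelianVariety ComplexPoints bettiCohomology IsSmoothProjective)

open scoped IntermediateField

/-! ### `d[E:ℚ] = 2 dim A` and `dim_ℚ W_F` -/

section WeilSpace

variable (A : AbelianVariety ℂ) (F : Type*) [Field F] [NumberField F]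
  [Module F (bettiCohomology A.X 1)] [IsScalarTower ℚ F (bettiCohomology A.X 1)]

/-- `H¹(A(ℂ); ℚ)` is a finite-dimensional `F`-vector space (it is finite-dimensional over `ℚ`).
[cite: Deligne1982HodgeCycles, §4 p. 30 ("Let d be the dimension of H₁(A, ℚ) over E")] -/
theorem finite_bettiCohomology_one_over : Module.Finite F (bettiCohomology A.X 1) :=
  haveI : Module.Finite ℚ (bettiCohomology A.X 1) :=
    finiteDimensional_bettiCohomology (AbelianVariety.isSmoothProjective_holds (A := A)) 1
  Module.Finite.of_restrictScalars_finite ℚ F (bettiCohomology A.X 1)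

/-- **"`d[E:ℚ] = 2 dim A`"**: for a number field `F` acting on `H¹(A(ℂ); ℚ)` (compatibly with `ℚ`),
`[F:ℚ] · dim_F H¹(A(ℂ); ℚ) = 2 dim A` — the tower law with `b₁(A) = 2 dim A` (Mumford §1 (3); the
tree's `Motives.AbelianVariety.finrank_bettiCohomology_one_eq_of_natCard_torsionPoints`).
[cite: Deligne1982HodgeCycles, §4 p. 30 ("Let d be the dimension of H₁(A, ℚ) over E, so that d[E:ℚ] = 2 dim A")]
[cite: MumfordAV1970, §1 (3)] -/
theorem finrank_mul_finrank_bettiCohomology_one :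
    finrank ℚ F * finrank F (bettiCohomology A.X 1) = 2 * A.dim := by
  rw [Module.finrank_mul_finrank]
  exact A.finrank_bettiCohomology_one_eq_of_natCard_torsionPoints
    (A.natCard_torsionPoints_of_isAlgClosed_holds ℂ)

/-- "`r = 2g/[F:ℚ]`": `dim_F H¹(A(ℂ); ℚ) = 2 dim A / [F:ℚ]`. [cite: MoonenZarhin1998WeilClasses, §1 ("let r = 2g/[F:ℚ]")] -/
theorem finrank_bettiCohomology_one_over_eq_div :
    finrank F (bettiCohomology A.X 1) = 2 * A.dim / finrank ℚ F := by
  rw [← finrank_mul_finrank_bettiCohomology_one A F,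
    Nat.mul_div_cancel_left _ (Module.finrank_pos (R := ℚ) (M := F))]

/-- **`W_F ≅ ⋀^r_F H¹(A(ℂ); ℚ)` in positive degree**: the map `e_r ∘ s : ⋀^r_F H¹ → H^r(A(ℂ); ℚ)`
whose range is `W_F` is injective for `r ≠ 0` (Deligne's section is injective,
`sectionExteriorPowerOver_injective`; the cup-product comparison `e_r` is bijective).
[cite: MoonenZarhin1998WeilClasses, §1 (Lemma (1): W_F ↪ ⋀^r_ℚ V)] [cite: Deligne1982HodgeCycles, §4 Lemma 4.3 (b)] -/
theorem equiv_comp_section_injective (r : ℕ) (hr : r ≠ 0) :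
    Injective (((hasExteriorCohomologyH1_rat_complexPoints A).equiv r).toLinearMap ∘ₗ
      sectionExteriorPowerOver ℚ F (bettiCohomology A.X 1) (traceForm_nondegenerate ℚ F) r) :=
  ((hasExteriorCohomologyH1_rat_complexPoints A).equiv r).injective.comp
    (sectionExteriorPowerOver_injective ℚ F (bettiCohomology A.X 1) (traceForm_nondegenerate ℚ F) r hr)

/-- `dim_ℚ W_F = dim_ℚ ⋀^r_F H¹(A(ℂ); ℚ)` for `r ≠ 0`. [cite: MoonenZarhin1998WeilClasses, §1 (Lemma (1))] -/
theorem finrank_weilSpace_eq_finrank_exteriorPower (r : ℕ) (hr : r ≠ 0) :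
    finrank ℚ (weilSpace A F r) = finrank ℚ (⋀[F]^r (bettiCohomology A.X 1)) := by
  rw [weilSpace_eq_range]
  exact LinearMap.finrank_range_of_inj (equiv_comp_section_injective A F r hr)

/-- **`dim_ℚ W_F = [F:ℚ] · binom(dim_F H¹, r)`** for `r ≠ 0` (tower law and the rank of an exterior
power of a free module, Mathlib `exteriorPower.finrank_eq`).
[cite: MoonenZarhin1998WeilClasses, §1 ("the 1-dimensional F-vector space W_F := ⋀^r_F V_X")]
[cite: Deligne1982HodgeCycles, §4 proof of Prop. 4.4 ("Each H¹_{B,σ} has dimension d")] -/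
theorem finrank_weilSpace (r : ℕ) (hr : r ≠ 0) :
    finrank ℚ (weilSpace A F r) = finrank ℚ F * (finrank F (bettiCohomology A.X 1)).choose r := by
  haveI := finite_bettiCohomology_one_over A F
  rw [finrank_weilSpace_eq_finrank_exteriorPower A F r hr,
    ← Module.finrank_mul_finrank ℚ F (⋀[F]^r (bettiCohomology A.X 1)), exteriorPower.finrank_eq]

/-- **"The 1-dimensional `F`-vector space `W_F`"**: in the degree `r = dim_F H¹(A(ℂ); ℚ)`
(`= 2 dim A/[F:ℚ]`), `dim_ℚ W_F = [F:ℚ]`, provided `dim A ≠ 0`.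
[cite: MoonenZarhin1998WeilClasses, §1 ("r = 2g/[F:ℚ]. The 1-dimensional F-vector space W_F")]
[cite: vanGeemen1994HodgeAV, 4.9 ("the two dimensional ℚ-vector space ⋀^{2n}_K H¹(X, ℚ)")] -/
theorem finrank_weilSpace_self (hA : A.dim ≠ 0) :
    finrank ℚ (weilSpace A F (finrank F (bettiCohomology A.X 1))) = finrank ℚ F := by
  have hr : finrank F (bettiCohomology A.X 1) ≠ 0 := by
    intro h
    have h2 := finrank_mul_finrank_bettiCohomology_one A F
    rw [h, mul_zero] at h2
    omega
  rw [finrank_weilSpace A F _ hr, Nat.choose_self, mul_one]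

end WeilSpace

/-! ### Base change does not change the dimension -/

section BaseChange

/-- `dim_ℂ (W ⊗ ℂ) = dim_ℚ W` for a `ℚ`-subspace `W ⊆ V`: `W ⊗ ℂ → V ⊗ ℂ` is injective (`ℂ` is flat
over `ℚ`) with range `W.baseChange ℂ`, and `dim_ℂ (ℂ ⊗_ℚ W) = dim_ℚ W`. [folklore] -/
private theorem finrank_baseChange_complex {V : Type*} [AddCommGroup V] [Module ℚ V]
    (W : Submodule ℚ V) : finrank ℂ (W.baseChange ℂ) = finrank ℚ W := by
  have hinj : Injective (W.subtype.baseChange ℂ) := by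
    rw [LinearMap.baseChange_eq_ltensor]
    exact Module.Flat.lTensor_preserves_injective_linearMap _ W.injective_subtype
  rw [Submodule.baseChange, LinearMap.finrank_range_of_inj hinj, Module.finrank_baseChange]

end BaseChange

/-! ### `dim_ℂ weilClassesField` -/

section Field

variable {A : AbelianVariety ℂ} {F : Type*} [Field F] [NumberField F]
  [Module F (bettiCohomology A.X 1)] [IsScalarTower ℚ F (bettiCohomology A.X 1)]

/-- Under the hypotheses of the identification `weilClassesField A φ P r = β_r(W_F ⊗ ℂ)`
(`weilClassesField_eq_map_baseChange_weilSpace`): **`dim_ℂ weilClassesField A φ P r = dim_ℚ W_F`**.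
[cite: MoonenZarhin1998WeilClasses, §1 (W_F ⊗ ℂ = ⊕_σ ⋀^r_ℂ V_{ℂ,σ})] -/
theorem finrank_weilClassesField_eq_finrank_weilSpace (hX : IsSmoothProjective A.dim A.X) (φ : A ⟶ A)
    {e : F} (he : ℚ⟮e⟯ = ⊤)
    (hφe : ∀ v : bettiCohomology A.X 1, e • v = (bettiCohomology.map φ.hom.hom.hom 1).hom v)
    {P : Polynomial ℤ} (hPirr : Irreducible (P.map (Int.castRingHom ℚ)))
    (hPe : aeval e (P.map (Int.castRingHom ℚ)) = 0) (r : ℕ) :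
    finrank ℂ (weilClassesField A φ P r) = finrank ℚ (weilSpace A F r) := by
  rw [weilClassesField_eq_map_baseChange_weilSpace hX φ he hφe hPirr hPe r, LinearEquiv.finrank_map_eq,
    finrank_baseChange_complex]

/-- **`dim_ℂ weilClassesField A φ P r = [F:ℚ] · binom(dim_F H¹, r)`** (`r ≠ 0`): the complexified
space of Weil classes is the sum over the `[F:ℚ]` embeddings `σ` of the spaces `⋀^r V_{ℂ,σ}`,
`dim V_{ℂ,σ} = dim_F H¹` ("Each `H¹_{B,σ}` has dimension `d`").
[cite: Deligne1982HodgeCycles, §4 proof of Prop. 4.4 ("Each H¹_{B,σ} has dimension d")]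
[cite: MoonenZarhin1998WeilClasses, §1 (W_F ⊗ ℂ = ⊕_σ ⋀^r_ℂ V_{ℂ,σ})] -/
theorem finrank_weilClassesField (hX : IsSmoothProjective A.dim A.X) (φ : A ⟶ A)
    {e : F} (he : ℚ⟮e⟯ = ⊤)
    (hφe : ∀ v : bettiCohomology A.X 1, e • v = (bettiCohomology.map φ.hom.hom.hom 1).hom v)
    {P : Polynomial ℤ} (hPirr : Irreducible (P.map (Int.castRingHom ℚ)))
    (hPe : aeval e (P.map (Int.castRingHom ℚ)) = 0) {r : ℕ} (hr : r ≠ 0) :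
    finrank ℂ (weilClassesField A φ P r) = finrank ℚ F * (finrank F (bettiCohomology A.X 1)).choose r := by
  rw [finrank_weilClassesField_eq_finrank_weilSpace hX φ he hφe hPirr hPe r, finrank_weilSpace A F r hr]

end Field

/-! ### The tree's presentation `F = ℚ(φ) ≅ ℚ[T]/(P)`: `dim_ℂ weilClassesField A φ P r = e` -/

section AdjoinRoot

variable {A : AbelianVariety ℂ}

/-- `[ℚ[T]/(P) : ℚ] = deg P` for `P ∈ ℤ[T]` irreducible over `ℚ` (Mathlib's power basis
`1, T, …, T^{deg P - 1}` of `AdjoinRoot`). [folklore] -/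
private theorem finrank_adjoinRoot_eq_natDegree (P : Polynomial ℤ)
    [Fact (Irreducible (P.map (Int.castRingHom ℚ)))] :
    finrank ℚ (AdjoinRoot (P.map (Int.castRingHom ℚ))) = P.natDegree := by
  rw [(AdjoinRoot.powerBasis (Fact.out : Irreducible (P.map (Int.castRingHom ℚ))).ne_zero).finrank,
    AdjoinRoot.powerBasis_dim, Polynomial.natDegree_map_eq_of_injective (RingHom.injective_int _)]

/-- **`dim_ℂ (W_F ⊗ ℂ) = [F:ℚ] = e`, with EXACTLY the hypotheses of
`HodgeTheory.MoonenZarhin1998_weilClasses_hodgeCriterion`** (and `r ≠ 0`): for a complex abelian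
variety `A`, `φ : A ⟶ A`, `P ∈ ℤ[T]` irreducible over `ℚ` of degree `e` with `P(φ) = 0` in `End A`,
and `e · r = 2 dim A`, the complexified space of Weil classes `weilClassesField A φ P r ⊆ H^r(A(ℂ); ℂ)`
— the carrier of `RankFourFaces.RankFourWeilClasses` for `r = 4` — has complex dimension `e`: it is
`W_{ℚ(φ)} ⊗ ℂ` for the `e`-dimensional `ℚ`-space `W_{ℚ(φ)} = ⋀^r_{ℚ(φ)} H¹(A(ℂ); ℚ)`
(`dim_{ℚ(φ)} H¹ = 2 dim A / e = r`, "`d[E:ℚ] = 2 dim A`"; "the 1-dimensional `F`-vector space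
`W_F`"), i.e. the direct sum of the `e` lines `⋀^r V_{ℂ,ρ}`, `P(ρ) = 0`.
[cite: MoonenZarhin1998WeilClasses, §1 ("r = 2g/[F:ℚ]. The 1-dimensional F-vector space W_F"; W_F ⊗ ℂ = ⊕_σ ⋀^r_ℂ V_{ℂ,σ})]
[cite: Deligne1982HodgeCycles, §4 p. 30 ("d[E:ℚ] = 2 dim A"; "Each H¹_{B,σ} has dimension d")] -/
theorem finrank_weilClassesField_eq_natDegree (hX : IsSmoothProjective A.dim A.X) (φ : A ⟶ A)
    {P : Polynomial ℤ} {e r : ℕ} (hPe : P.natDegree = e) (hPirr : Irreducible (P.map (Int.castRingHom ℚ)))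
    (hφ : Polynomial.eval₂ (Int.castRingHom (CategoryTheory.End A)) (φ : CategoryTheory.End A) P = 0)
    (her : e * r = 2 * A.dim) (hr : r ≠ 0) :
    finrank ℂ (weilClassesField A φ P r) = e := by
  letI := adjoinRootModule φ P hφ
  haveI := adjoinRootModule_isScalarTower φ P hφ
  haveI : Fact (Irreducible (P.map (Int.castRingHom ℚ))) := ⟨hPirr⟩
  have hF : finrank ℚ (AdjoinRoot (P.map (Int.castRingHom ℚ))) = e := by
    rw [finrank_adjoinRoot_eq_natDegree, hPe]
  have he0 : e ≠ 0 := by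
    rw [← hF]
    exact (Module.finrank_pos (R := ℚ) (M := AdjoinRoot (P.map (Int.castRingHom ℚ)))).ne'
  have hd : finrank (AdjoinRoot (P.map (Int.castRingHom ℚ))) (bettiCohomology A.X 1) = r := by
    have h := finrank_mul_finrank_bettiCohomology_one A (AdjoinRoot (P.map (Int.castRingHom ℚ)))
    rw [hF, ← her] at h
    exact Nat.eq_of_mul_eq_mul_left (Nat.pos_of_ne_zero he0) h
  rw [finrank_weilClassesField hX φ (IntermediateField.adjoin_root_eq_top (P.map (Int.castRingHom ℚ)))
      (adjoinRootModule_root_smul φ P hφ) hPirr _ hr, hF, hd, Nat.choose_self, mul_one]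
  rw [aeval_def, Subsingleton.elim (algebraMap ℚ (AdjoinRoot (P.map (Int.castRingHom ℚ))))
    (AdjoinRoot.of (P.map (Int.castRingHom ℚ))), AdjoinRoot.eval₂_root]

end AdjoinRoot

end Literature.AlgebraicGeometry.Deligne1982
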